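import Summits.ValiantsHypothesis.ValiantsHypothesis.Theorems.BarrierLeverAnchoredDoorHitsLowerPairsConjLReduction
import Summits.ValiantsHypothesis.ValiantsHypothesis.Theorems.BarrierLeverAnchoredDoorHitsLowerPairsUQFaceStepProof
import Summits.ValiantsHypothesis.ValiantsHypothesis.Theorems.BarrierLeverAnchoredDoorHitsLowerPairsMono

/-!
# Support item `AnchoredDoorHitsLowerPairs` (stmt-ValiantsHypothesis-22510), line `anchored-peeling`:
# SPLITTING THE FACE-UQ RESIDUAL — Conjecture L takes the cube-versus-complex pairs, a typed REST takes the others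

Helper file (`--supports stmt-ValiantsHypothesis-22510`; cell valiant-natproofs, rung V4, 𝒟-side door (c); registered line
`Cruxes/AnchoredDoorHitsLowerPairs/Lines/anchored_peeling.lean` v14/v15, composition `AnchoredDoorHitsLowerPairs_of : Stmt.stub_uqFaceStep (LANDED, p626525) →
Stmt.stub_uqFaceResidual → AnchoredDoorHitsLowerPairs`; prover seat val-np-p1 gen 20). Planner ruling R1 (STATUS l.1183) asked for the registration path
«(1) kernel multi-peel `Stmt.stub_conjL → ResidualDeepBall`, (2) typed complement residual, (3) lossless merger of `stub_uqFaceResidual`». This file provides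
(1)+(2)+(3) as ONE kernel implication. Closes NO item.

* `IsCubeComplexPair u w` — the rows are ALL subsets of an `x`-vertex set `π(Γ)` and the columns are faces of the `(|Γ|+1)`-set `Γ ∪ {c₀}` (branch (i) of the
  fixed-profile residual: «cube versus a complex on one more vertex», memo HOME/val-np-p1/g19/PEEL-HALL-valnp1-g19.md §19–§20).
* `Stmt.stub_uqFaceResidualRest` — the registered residual text `Stmt.stub_uqFaceResidual` (p614490) with the two extra hypotheses «not a cube-versus-complex
  pair on either side» (OFFERED stub text, D-0145; census-empty like its parent; first theoretical members = branch (ii) «deep versus very wide»,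
  cube_n vs truncated B(q, s+1), q > (s+1)·2^{s+1}).
* `stub_uqFaceResidual_of_conjL_rest : Stmt.stub_conjL → Stmt.stub_uqFaceResidualRest → Stmt.stub_uqFaceResidual` — **the lossless merger (kernel-checked)**:
  cube-versus-complex pairs on the `x`-side by `symbolicDet_one_ne_zero_of_conjL` (p628068) and `symbolicDet_ne_zero_mono`, on the `y`-side by
  `symbolicDet_ne_zero_comm`, everything else by the rest stub.
* `anchoredDoorHitsLowerPairs_of_conjL_rest` — hence `Stmt.stub_conjL → Stmt.stub_uqFaceResidualRest → AnchoredDoorHitsLowerPairs` (route decl BY NAME,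
  through `stub_uqFaceStep` and the landed induction).

WHAT THIS IS NOT: Conjecture L and the rest stub are OPEN; nothing on crux stmt-ValiantsHypothesis-14610 or on `VP` versus `VNP`.
-/

set_option linter.dupNamespace false

namespace Summit.ValiantsHypothesis.ValiantsHypothesis.Theorems.BarrierLever.AnchoredPeeling

open Finset MvPolynomial

noncomputable section

variable {h : ℕ}

/-- **Cube-versus-complex data** (branch (i) of the fixed-profile residual): for some `y`-vertex set `Γ`, extra vertex `c₀ ∉ Γ` and vertex permutation `π`,
the row faces are EXACTLY the subsets of `π(Γ)` and every column face lies in `Γ ∪ {c₀}`. -/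
def IsCubeComplexPair {r : ℕ} (u w : Fin r → Finset (Fin h)) : Prop :=
  ∃ (Γ : Finset (Fin h)) (c₀ : Fin h) (π : Equiv.Perm (Fin h)), c₀ ∉ Γ ∧ (∀ S, S ∈ Set.range u ↔ S ⊆ Γ.image π) ∧ ∀ j, w j ⊆ insert c₀ Γ

/-- **STUB TEXT (offered): THE FACE-UQ RESIDUAL MINUS THE CUBE-VERSUS-COMPLEX PAIRS.** At some fixed profile `s ≥ 1` and all `h ≥ h₀`: every injective
simplicial-complex pair with `r ≥ 2` rows, NO face-UQ data on either side, and which is NOT a cube-versus-complex pair on either side, has nonzero symbolic minor. -/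
def Stmt.stub_uqFaceResidualRest : Prop :=
  ∃ s h₀ : ℕ, 1 ≤ s ∧ ∀ h : ℕ, h₀ ≤ h → ∀ (r : ℕ) (u w : Fin r → Finset (Fin h)),
    Function.Injective u → Function.Injective w → IsLowerSet (Set.range u) → IsLowerSet (Set.range w) → 2 ≤ r →
    (∀ (a : Fin h) (W₀ : Finset (Fin h)) (𝒜 : Finset (Finset (Fin h))) (ρ : Finset (Fin h) → Finset (Fin h)), ¬ UQFData s u w a W₀ 𝒜 ρ) →
    (∀ (c : Fin h) (Z : Finset (Fin h)) (𝒜 : Finset (Finset (Fin h))) (ρ : Finset (Fin h) → Finset (Fin h)), ¬ UQFData s w u c Z 𝒜 ρ) →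
    ¬ IsCubeComplexPair u w → ¬ IsCubeComplexPair w u →
    symbolicDet s h r u w ≠ 0

/-- **The lossless merger (kernel-checked): Conjecture L ∧ rest ⟹ the registered residual `Stmt.stub_uqFaceResidual`.** -/
theorem stub_uqFaceResidual_of_conjL_rest (hL : Stmt.stub_conjL) (hR : Stmt.stub_uqFaceResidualRest) : Stmt.stub_uqFaceResidual := by
  obtain ⟨s, h₀, hs, hR⟩ := hR
  refine ⟨s, h₀, hs, fun h hh r u w hu hw hlu hlw hr hx hy => ?_⟩
  by_cases hcx : IsCubeComplexPair u w
  · obtain ⟨Γ, c₀, π, hc₀, hrows, hcols⟩ := hcx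
    exact symbolicDet_ne_zero_mono hs (symbolicDet_one_ne_zero_of_conjL hL u w hu hw hlw Γ c₀ hc₀ π hrows hcols)
  · by_cases hcy : IsCubeComplexPair w u
    · obtain ⟨Γ, c₀, π, hc₀, hrows, hcols⟩ := hcy
      exact (symbolicDet_ne_zero_comm s h r u w).mpr
        (symbolicDet_ne_zero_mono hs (symbolicDet_one_ne_zero_of_conjL hL w u hw hu hlu Γ c₀ hc₀ π hrows hcols))
    · exact hR h hh r u w hu hw hlu hlw hr hx hy hcx hcy

/-- Hence the line's symbolic non-vanishing stub from Conjecture L and the rest (through the landed face-UQ step and induction). -/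
theorem stub_symbolicNonvanishing_of_conjL_rest (hL : Stmt.stub_conjL) (hR : Stmt.stub_uqFaceResidualRest) :
    Stmt.stub_symbolicNonvanishing :=
  stub_symbolicNonvanishing_of_uqFace stub_uqFaceStep (stub_uqFaceResidual_of_conjL_rest hL hR)

/-- **Composition BY NAME: Conjecture L ∧ rest ⟹ the support item `AnchoredDoorHitsLowerPairs`** (route decl), via the anchored door and its size bound. -/
theorem anchoredDoorHitsLowerPairs_of_conjL_rest (hL : Stmt.stub_conjL) (hR : Stmt.stub_uqFaceResidualRest) :
    Summit.ValiantsHypothesis.ValiantsHypothesis.Theses.BarrierLever.AnchoredDoorHitsLowerPairs := by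
  obtain ⟨s, h₀, K⟩ := anchoredHit_of_uqFace stub_uqFaceStep (stub_uqFaceResidual_of_conjL_rest hL hR)
  exact ⟨s, h₀, fun h hh r u w hu hw hlu hlw => K h hh r u w hu hw hlu hlw⟩

end

end Summit.ValiantsHypothesis.ValiantsHypothesis.Theorems.BarrierLever.AnchoredPeeling
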